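import Summits.AtomisticToContinuum.Crystallization.Theorems.ChargedEnergyGapStabilityNumerics
import HarnessLib

/-!
# `ChargedEnergyGap` — the ROTATION TEST of the re-typed transfer piece (H𝄪ʳ): site virials, the typed profile-form test, and its VOID
# under site-stress-free references (cell `decomp-a2c`, lens 3, generation 61, part P-M «RotationTest»; over part P-L
# `…Theorems.ChargedEnergyGapStabilityNumerics`)

ROT-OSC (critic rows 1104 remainder, 1115 (4), 1124 (4), 1131 (b)).  Inside `LocalSeamTransferBoundR` (= (H𝄪ʳ), part P-I(2/2)) the instance «no seams
(`k = 0`), no localisation (`m = 0`), no excision (`X = ∅`), base cocycle = the rotation cocycle `rotField r₀ v` (`W r = ⟪r, r₀⟫v − ⟪r, v⟫r₀`)» is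
admissible as soon as `2‖r₀‖‖v‖ ≤ τ` (`smallStrain_rotField`), and on it the piece reads — BY KERNEL COMPUTATION, all allowances but the shell's
dropping out (`transMassL_fin_zero`, `pricedNearCount` of `X = ∅` is `0`, `linSite_rotField`) —
  ★ `rotProfileTest_of_R : (H𝄪ʳ) → RotProfileTest`,
  `RotProfileTest … := ∀ admissible P, ∀ Λ_P-invariant C, ∀ r₀ v, 2‖r₀‖‖v‖ ≤ τ →
      −C_T·#shell(P, ϱ, C) ≤ λ·Σ_{y ∈ motif} w_C(y)·quadSite (rotField r₀ v) P ∅ y`,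
with the site term the CONTRACTION OF THE SITE VIRIAL (`quadSite_rotField_empty`):
  `quadSite (rotField r₀ v) P ∅ y = ¼(‖v‖²·T_y(r₀,r₀) − 2⟪v,r₀⟫·T_y(r₀,v) + ‖r₀‖²·T_y(v,v))`,
  `T_y(a,b) = siteVirial P y a b := Σ'_{z ∈ P, z ≠ y} (V′(d)/d)⟪z − y, a⟫⟪z − y, b⟫` (the summand of `IsStressFree`, per site; `IsStressFree P ↔
  ∀ a b, Σ_{y ∈ motif} T_y(a,b) = 0`, `isStressFree_iff_sum_siteVirial`).
`RotProfileTest` at the record dials is the functional the seat's census evaluates (memo g61 §9, `num/rotosc*.py`): it FAILS on coherent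
two-block superpolytype references (fcc block in tension, hcp block in compression; violation ratio linear in the slab thickness of `C`), so (H𝄪ʳ)
is FALSE-leaning AS TYPED — a census verdict (the violating references are admissible but their `HarmStableModRot` is not kernel-certifiable at
motif sizes `10³`), recorded here only as the typed target.

THE RE-TYPING (R2) of memo §9.5 and its two kernel facts: `IsSiteStressFree P := ∀ y ∈ motif, ∀ a b, T_y(a,b) = 0` (implies `IsStressFree`,
`IsSiteStressFree.isStressFree`; equivalent to it for one-point motifs, `isSiteStressFree_of_motif_eq_singleton`);
  ★ `quadSite_rotField_eq_zero`, `sum_weight_quadSite_rotField_eq_zero`, `modelFarL_rotField_eq_zero` — under `IsSiteStressFree` the rotation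
    test is VOID: every weighted / localised model of every rotation cocycle without excision is `0` (so ROT-OSC reduces to the excision term,
    memo §9.5), and `RotProfileTest`'s conclusion holds with right-hand side `0` (`rotProfileTest_conclusion_of_siteStressFree`);
  ★★ `Fcc.isSiteStressFree_fcc`, `Fcc.exists_admissible_siteStressFree_harmStableModRot` — the P-L witness `fccRef a₀` inhabits the re-typed
    hypothesis block `IsSeparatedRef (3/5) ∧ IsLabelledRef (1/3) 3 ∧ IsForceFree ∧ IsSiteStressFree ∧ HarmStableModRot (1/100)` (one-point motif).

All `[this work]`.  No `sorry`, no `native_decide`, no new axioms; every theorem `[propext, Classical.choice, Quot.sound]`.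
-/

noncomputable section

open scoped Classical
open Literature.MathematicalPhysics.StatisticalMechanics
open Literature.Geometry.DiscreteGeometry
open Summit.AtomisticToContinuum.Crystallization.Theses.PricedLinkCensus
open Summit.AtomisticToContinuum.Crystallization.Theorems.ChargedEnergyGapNegative

namespace Summit.AtomisticToContinuum.Crystallization.Theorems.ChargedEnergyGapChartDial

/-! ## §M1 Site virials and site-stress-free references -/

section SiteVirial

/-- The **SITE VIRIAL** `T_y(a, b) = Σ'_{z ∈ P, z ≠ y} (V′(d_yz)/d_yz)·⟪z − y, a⟫⟪z − y, b⟫` — the summand of `IsStressFree`, per site (absolutely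
convergent, `summable_virial`). -/
def siteVirial (P : PeriodicConfiguration 3) (y a b : E3) : ℝ :=
  ∑' z : {z : E3 // z ∈ P.points ∧ z ≠ y}, ljD1 (dist y z) / dist y (z : E3) * (inner ℝ ((z : E3) - y) a * inner ℝ ((z : E3) - y) b)

/-- **SITE-STRESS-FREE** reference: every site virial vanishes (not only their sum over the motif).  fcc and hcp (site-transitive stress-free
equilibria) are; no other Barlow stacking is (memo g61 §9.2: dhcp carries `±(−3.35·10⁻⁴, −3.35·10⁻⁴, +9.6·10⁻⁴)` per layer). -/
def IsSiteStressFree (P : PeriodicConfiguration 3) : Prop :=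
  ∀ y ∈ P.motif, ∀ a b : E3, siteVirial P y a b = 0

variable {P : PeriodicConfiguration 3}

/-- `IsStressFree` is the vanishing of the motif SUM of the site virials (definitional). -/
theorem isStressFree_iff_sum_siteVirial : IsStressFree P ↔ ∀ a b : E3, ∑ y ∈ P.motif, siteVirial P y a b = 0 :=
  Iff.rfl

/-- Site-stress-free ⟹ stress-free. -/
theorem IsSiteStressFree.isStressFree (h : IsSiteStressFree P) : IsStressFree P :=
  fun a b => Finset.sum_eq_zero fun y hy => h y hy a b

/-- For a ONE-POINT motif the two notions coincide. -/
theorem isSiteStressFree_of_motif_eq_singleton {y₀ : E3} (hm : P.motif = {y₀}) (hS : IsStressFree P) : IsSiteStressFree P := by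
  intro y hy a b
  have h := hS a b
  rw [hm, Finset.sum_singleton] at h
  rw [hm, Finset.mem_singleton] at hy
  subst hy
  exact h

/-- `isSiteStressFree_iff_of_motif_eq_singleton` (docstring added by the landing lane; see the module docstring). [formal bookkeeping] -/
theorem isSiteStressFree_iff_of_motif_eq_singleton {y₀ : E3} (hm : P.motif = {y₀}) : IsSiteStressFree P ↔ IsStressFree P :=
  ⟨IsSiteStressFree.isStressFree, isSiteStressFree_of_motif_eq_singleton hm⟩

/-- The site virial is symmetric in its two vector arguments. -/
theorem siteVirial_comm (P : PeriodicConfiguration 3) (y a b : E3) : siteVirial P y a b = siteVirial P y b a := by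
  unfold siteVirial
  exact tsum_congr fun z => by ring

end SiteVirial

/-! ## §M2 The rotation cocycle: site term = contraction of the site virial; strain bound -/

section RotField

variable (P : PeriodicConfiguration 3)

/-- ★ With no excision, the quadratic site term of the rotation cocycle `rotField r₀ v` is the contraction of the SITE VIRIAL with `WᵀW`:
`¼(‖v‖²·T_y(r₀,r₀) − 2⟪v,r₀⟫·T_y(r₀,v) + ‖r₀‖²·T_y(v,v))` (the summable split of part P-I(1/2), per site). -/
theorem quadSite_rotField_empty (r₀ v y : E3) :
    quadSite (rotField r₀ v) P ∅ y =
      (1 / 4) * (‖v‖ ^ 2 * siteVirial P y r₀ r₀ - 2 * inner ℝ v r₀ * siteVirial P y r₀ v + ‖r₀‖ ^ 2 * siteVirial P y v v) := by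
  rw [quadSite_empty_eq]
  congr 1
  unfold siteVirial
  have h1 := summable_virial P y r₀ r₀
  have h2 := summable_virial P y r₀ v
  have h3 := summable_virial P y v v
  rw [← tsum_mul_left, ← tsum_mul_left, ← tsum_mul_left, ← (h1.mul_left _).tsum_sub (h2.mul_left _),
    ← ((h1.mul_left _).sub (h2.mul_left _)).tsum_add (h3.mul_left _)]
  refine tsum_congr fun z => ?_
  rw [bondQuad_rotField, norm_rotField_sq]
  ring

/-- The rotation cocycle is `2‖r₀‖‖v‖`-Lipschitz in the bond vector … -/
theorem norm_rotField_le (r₀ v y z : E3) : ‖rotField r₀ v y z‖ ≤ 2 * (‖r₀‖ * ‖v‖) * dist y z := by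
  unfold rotField
  have hr : ‖z - y‖ = dist y z := by rw [dist_eq_norm, norm_sub_rev]
  have ha : |inner ℝ (z - y) r₀| ≤ ‖z - y‖ * ‖r₀‖ := abs_real_inner_le_norm _ _
  have hb : |inner ℝ (z - y) v| ≤ ‖z - y‖ * ‖v‖ := abs_real_inner_le_norm _ _
  calc ‖inner ℝ (z - y) r₀ • v - inner ℝ (z - y) v • r₀‖
      ≤ ‖inner ℝ (z - y) r₀ • v‖ + ‖inner ℝ (z - y) v • r₀‖ := norm_sub_le _ _
    _ = |inner ℝ (z - y) r₀| * ‖v‖ + |inner ℝ (z - y) v| * ‖r₀‖ := by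
        rw [norm_smul, norm_smul, Real.norm_eq_abs, Real.norm_eq_abs]
    _ ≤ ‖z - y‖ * ‖r₀‖ * ‖v‖ + ‖z - y‖ * ‖v‖ * ‖r₀‖ := by gcongr
    _ = 2 * (‖r₀‖ * ‖v‖) * dist y z := by rw [hr]; ring

/-- … so it obeys `SmallStrain τ` (on every excised set) as soon as `2‖r₀‖‖v‖ ≤ τ`. -/
theorem smallStrain_rotField {τ : ℝ} (X : Set E3) {r₀ v : E3} (h : 2 * (‖r₀‖ * ‖v‖) ≤ τ) : SmallStrain τ P X (rotField r₀ v) :=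
  fun y _ z _ _ _ => (norm_rotField_le r₀ v y z).trans (mul_le_mul_of_nonneg_right h dist_nonneg)

/-- The P-A model of a rotation cocycle is `λ` times the weighted quadratic site terms (every linear site term vanishes, `linSite_rotField`). -/
theorem modelFar_rotField (X : Set E3) (lamQ ϱ : ℝ) (C : Set E3) (r₀ v : E3) :
    modelFar (rotField r₀ v) P X lamQ ϱ C = lamQ * ∑ y ∈ P.motif, if y ∈ X then 0 else profileWeight ϱ C y * quadSite (rotField r₀ v) P X y := by
  unfold modelFar
  rw [Finset.mul_sum]
  refine Finset.sum_congr rfl fun y _ => ?_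
  split_ifs
  · simp
  · rw [linSite_rotField]; ring

variable (ϱχ : ℝ) {m : ℕ} (D : Fin m → Set E3) (σ : Fin m → Bool)

/-- The same for the LOCALISED model of part P-D. -/
theorem modelFarL_rotField (X : Set E3) (lamQ ϱ : ℝ) (C : Set E3) (r₀ v : E3) :
    modelFarL ϱχ D σ (rotField r₀ v) P X lamQ ϱ C =
      lamQ * ∑ y ∈ P.motif, if y ∈ X then 0 else localFactor ϱχ D σ y * (profileWeight ϱ C y * quadSite (rotField r₀ v) P X y) := by
  unfold modelFarL
  rw [Finset.mul_sum]
  refine Finset.sum_congr rfl fun y _ => ?_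
  split_ifs
  · simp
  · rw [linSite_rotField]; ring

end RotField

/-! ## §M3 ★ The typed PROFILE-FORM ROTATION TEST of (H𝄪ʳ) -/

section RotTest

variable (s lam ℓ μ₀ τ lamQ ϱ C_T : ℝ)

/-- **THE PROFILE-FORM ROTATION TEST** at dials `(s, lam, ℓ, μ₀, τ, λ, ϱ, C_T)`: for every admissible reference, every `Λ_P`-invariant centre set
and every rotation cocycle of strain `≤ τ`, the shell allowance alone bounds the weighted rotation site terms from below:
`−C_T·#shell ≤ λ·Σ_{y ∈ motif} w_C(y)·quadSite (rotField r₀ v) P ∅ y`.  A CONSEQUENCE of (H𝄪ʳ) (`rotProfileTest_of_R`); the functional evaluated by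
the seat's census (memo g61 §9: violated at the record by coherent block superpolytypes). -/
def RotProfileTest : Prop :=
  ∀ (P : PeriodicConfiguration 3) (C : Set E3) (r₀ v : E3),
    IsSeparatedRef s P → IsLabelledRef lam ℓ P → IsForceFree P → IsStressFree P → HarmStableModRot μ₀ P →
    IsInvariantSet P C → 2 * (‖r₀‖ * ‖v‖) ≤ τ →
      -(C_T * (modelShellCount P ∅ ϱ C : ℝ)) ≤ lamQ * ∑ y ∈ P.motif, profileWeight ϱ C y * quadSite (rotField r₀ v) P ∅ y

variable {s lam ℓ μ₀ τ lamQ ϱ C_T}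

/-- The empty set is `Λ_P`-invariant. -/
theorem isInvariantSet_empty (P : PeriodicConfiguration 3) : IsInvariantSet P ∅ := by
  intro g _ q
  simp

/-- With no excision nothing is priced. -/
theorem pricedNearCount_empty_excised (P : PeriodicConfiguration 3) (ϱ : ℝ) (C : Set E3) : pricedNearCount P ∅ ϱ C = 0 := by
  simp [pricedNearCount]

/-- ★ **(H𝄪ʳ) ⟹ THE PROFILE-FORM ROTATION TEST**: instantiate (H𝄪ʳ) at `X = ∅`, no seams, no localisation, `β₀ = rotField r₀ v`; the Volterra field is
`β₀` (`volterraField_fin_zero`), the empty system is a seam system, the localised masses are the plain ones (`shellMassL_fin_zero`,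
`transMassL_fin_zero = 0`, `pricedNearCountL_fin_zero`, `modelFarL_fin_zero`), nothing is priced, and the model is `λ·Σ w·quadSite` (`modelFar_rotField`). -/
theorem rotProfileTest_of_R {b₀ r_S ϱχ Cχ : ℝ} (h : LocalSeamTransferBoundR s lam ℓ μ₀ τ lamQ ϱ b₀ r_S C_T ϱχ Cχ) :
    RotProfileTest s lam ℓ μ₀ τ lamQ ϱ C_T := by
  obtain ⟨C_H, _, h⟩ := h
  intro P C r₀ v h1 h2 h3 h4 h5 hC hτ
  have hsm : SmallStrain τ P ∅ (volterraField P (fun i : Fin 0 => i.elim0) (rotField r₀ v)) := by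
    rw [volterraField_fin_zero]
    exact smallStrain_rotField P ∅ hτ
  have key := h P C ∅ (rotField r₀ v) 0 (fun i : Fin 0 => i.elim0) 0 (fun i : Fin 0 => i.elim0) (fun i : Fin 0 => i.elim0)
    h1 h2 h3 h4 h5 hC (isInvariantSet_empty P) (isGlobalCocycle_rotField P r₀ v) (isSeamSystem_fin_zero _) hsm (fun i => i.elim0)
  rw [volterraField_fin_zero, shellMassL_fin_zero, transMassL_fin_zero, pricedNearCountL_fin_zero, modelFarL_fin_zero,
    pricedNearCount_empty_excised, modelFar_rotField] at key
  simpa using key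

end RotTest

/-! ## §M4 ★ Under (R2) the rotation test is VOID: site-stress-free references -/

section Void

variable {P : PeriodicConfiguration 3}

/-- ★ At a SITE-stress-free reference the no-excision quadratic site term of every rotation cocycle vanishes AT EVERY SITE (not only in the
motif sum, `sum_quadSite_rotField_eq_zero`). -/
theorem quadSite_rotField_eq_zero (hS : IsSiteStressFree P) {y : E3} (hy : y ∈ P.motif) (r₀ v : E3) :
    quadSite (rotField r₀ v) P ∅ y = 0 := by
  rw [quadSite_rotField_empty, hS y hy r₀ r₀, hS y hy r₀ v, hS y hy v v]
  ring

/-- Hence every WEIGHTED sum of them over the motif vanishes … -/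
theorem sum_weight_quadSite_rotField_eq_zero (hS : IsSiteStressFree P) (wt : E3 → ℝ) (r₀ v : E3) :
    ∑ y ∈ P.motif, wt y * quadSite (rotField r₀ v) P ∅ y = 0 :=
  Finset.sum_eq_zero fun y hy => by rw [quadSite_rotField_eq_zero hS hy, mul_zero]

/-- … in particular the P-A model and the LOCALISED model of every rotation cocycle, for every centre set, every localisation list and pattern,
WITHOUT excision: ROT-OSC is void under (R2) up to the excision term (memo g61 §9.5). -/
theorem modelFar_rotField_eq_zero (hS : IsSiteStressFree P) (lamQ ϱ : ℝ) (C : Set E3) (r₀ v : E3) :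
    modelFar (rotField r₀ v) P ∅ lamQ ϱ C = 0 := by
  rw [modelFar_rotField]
  refine mul_eq_zero_of_right _ (Finset.sum_eq_zero fun y hy => ?_)
  simp [quadSite_rotField_eq_zero hS hy]

/-- `modelFarL_rotField_eq_zero` (docstring added by the landing lane; see the module docstring). [formal bookkeeping] -/
theorem modelFarL_rotField_eq_zero (hS : IsSiteStressFree P) (ϱχ : ℝ) {m : ℕ} (D : Fin m → Set E3) (σ : Fin m → Bool) (lamQ ϱ : ℝ)
    (C : Set E3) (r₀ v : E3) : modelFarL ϱχ D σ (rotField r₀ v) P ∅ lamQ ϱ C = 0 := by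
  rw [modelFarL_rotField]
  refine mul_eq_zero_of_right _ (Finset.sum_eq_zero fun y hy => ?_)
  simp [quadSite_rotField_eq_zero hS hy]

/-- ★ So the conclusion of the profile-form rotation test HOLDS at every site-stress-free reference for every `C_T ≥ 0` (right-hand side `0`). -/
theorem rotProfileTest_conclusion_of_siteStressFree (hS : IsSiteStressFree P) {C_T : ℝ} (hT : 0 ≤ C_T) (lamQ ϱ : ℝ) (C : Set E3) (r₀ v : E3) :
    -(C_T * (modelShellCount P ∅ ϱ C : ℝ)) ≤ lamQ * ∑ y ∈ P.motif, profileWeight ϱ C y * quadSite (rotField r₀ v) P ∅ y := by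
  rw [sum_weight_quadSite_rotField_eq_zero hS, mul_zero, neg_nonpos]
  exact mul_nonneg hT (Nat.cast_nonneg _)

end Void

/-! ## §M5 ★★ The P-L witness inhabits the re-typed hypothesis block (R2) -/

namespace Fcc

/-- The stress-free fcc reference `a₀·D₃` (one-point motif) is SITE-stress-free. -/
theorem isSiteStressFree_fcc : IsSiteStressFree (fccRef a0 a0_pos) :=
  isSiteStressFree_of_motif_eq_singleton (fccRef_motif a0 a0_pos) (isStressFree_fcc a0 a0_pos S_a0_eq_zero)

/-- ★★ The hypothesis block of the (R2)-re-typed (H𝄪ʳ) — `IsStressFree` strengthened to `IsSiteStressFree` — is INHABITED at the record dials by the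
P-L witness `fccRef a₀` (`fcc_witness`, `harmStableModRot_fcc_a0_record`). -/
theorem exists_admissible_siteStressFree_harmStableModRot : ∃ P : PeriodicConfiguration 3,
    IsSeparatedRef (3 / 5) P ∧ IsLabelledRef (1 / 3) 3 P ∧ IsForceFree P ∧ IsSiteStressFree P ∧ HarmStableModRot (1 / 100) P :=
  ⟨fccRef a0 a0_pos, fcc_witness.1, fcc_witness.2.1, fcc_witness.2.2.1, isSiteStressFree_fcc, harmStableModRot_fcc_a0_record⟩

/-- Sanity: at the fcc witness the rotation test's right-hand side is `0` for every centre set and rotation. -/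
theorem rotProfileTest_rhs_fcc (lamQ ϱ : ℝ) (C : Set E3) (r₀ v : E3) :
    lamQ * ∑ y ∈ (fccRef a0 a0_pos).motif, profileWeight ϱ C y * quadSite (rotField r₀ v) (fccRef a0 a0_pos) ∅ y = 0 := by
  rw [sum_weight_quadSite_rotField_eq_zero isSiteStressFree_fcc, mul_zero]

end Fcc

end Summit.AtomisticToContinuum.Crystallization.Theorems.ChargedEnergyGapChartDial

end
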